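import Summits.BirchSwinnertonDyer.BirchSwinnertonDyer.Theorems.CyclotomicUntwistPSLocalThreeTorsionII
import HarnessLib

/-!
# The `v₃N = 4` row of the O6 SHAPE LAW `WildThreeResidualShapeByKodaira` is a THEOREM:
# on the principal-series rows, ORD-side ⟺ Kodaira `IV*`/`II*` ⟺ `v₃Δ_min ≥ 10`, ET-side ⟺ `II`/`IV`

Cell `pub/bsd-wall` (D-0145 line `route-BirchSwinnertonDyer-CyclotomicUntwist`), seat `bsd-line-cycu-p2`
(prover seat 2/3, gen 3), helper toward K1 `PSRankOneLowerHalfAtThree` (stmt-BirchSwinnertonDyer-21580) and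
K2 `PSRankOneUpperHalfAtThree` (stmt-21581). THEOREMS ONLY (no definition, no named fact, no `sorry`); BSD
is not proved by this file, no crux is, and the `@[conjecture]` node `WildThreeResidualShapeByKodaira`
(`Additive/WildThreeResidualShapeLaws.lean`, o6-r1 V10: census 154 058/154 058) is NOT discharged — only its
conductor-exponent-`4` row (the cyclic wild cell `SubWCyclic`, i.e. `ClassO6 W 3 ∧ Even (v₃Δ_min)`,
`PSKodairaDictionary.condExp_eq_four_iff_even`) is proved here, for every such `W`:
`wildThreeResidualShapeByKodaira_row_four`. The rows `v₃N ∈ {3, 5}` (dicyclic cell) stay open.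

## Proof
x11b3's kernel reformulation `wildThreeResidualShapeByKodaira_iff_even_c₆` turns the law into the PARITY of
`v₃(c₆)` per cell (the stable-line sign is `(−1/216)·c₆·unit`, `shapeOrdSideThree_iff_even`,
`shapeEtSideThree_iff_odd`); this seat's Kraus middle entry (`PSTamagawaThree.padicValInt_c₆_of_classO6_of_even`,
p605352: `(v₃Δ_min, v₃c₆) ∈ {(4,3), (6,5), (10,6), (12,8)}`) supplies the parity, and the PS Kodaira dictionary
(`kodairaSymbolAt_of_even`) the symbol: `v₃c₆` is even exactly on `IV*` (`v = 10`) and `II*` (`v = 12`), the two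
symbols with `ordSideKodairaThree 4 · = true`. Also recorded: the `II` and `IV` rows ARE a one-stable-line locus
(`…PSLocalThreeTorsionII/Et.lean`), on which ET1 (`W(ℚ₃)[3] ≠ 0`) vs ETM is read by `c₆/3^{v₃c₆} mod 3`.
References: A. Kraus, Manuscripta Math. 69 (1990), Théorème (p = 3) [Kraus1990]; J.-P. Serre, Invent. Math. 15
(1972), §1.11 [Serre1972]; I. Papadopoulos, J. Number Theory 44 (1993), Table (p = 3) [Papadopoulos1993].
-/

set_option autoImplicit false
-- single-conjunct summit: `Summit.BirchSwinnertonDyer.BirchSwinnertonDyer.…` repeats the name by design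
set_option linter.dupNamespace false

noncomputable section

open scoped Classical

open WeierstrassCurve IsDedekindDomain Rat.HeightOneSpectrum Literature.NumberTheory.EllipticCurves
  Literature.NumberTheory.EllipticCurves.Rank1Residual Literature.NumberTheory.DiophantineGeometry
  Summit.BirchSwinnertonDyer.Rank1Residual.Additive Summit.BirchSwinnertonDyer.Rank1Residual.O5

namespace Summit.BirchSwinnertonDyer.BirchSwinnertonDyer.Theorems.PSLocalThreeTorsion

section RowFour

variable (W : WeierstrassCurve ℚ) [W.IsElliptic] [W.IsGloballyMinimal]

/-- **Parity of `v₃(c₆)` on the principal-series rows**: `v₃(c₆)` is even iff `v₃Δ_min ≥ 10` (Kraus middle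
entry `3, 5, 6, 8` at `v = 4, 6, 10, 12`), in `padicValRat` currency. [cite: Kraus1990, Théorème (p = 3)] -/
theorem even_padicValRat_c₆_iff_of_psRow (hO6 : ClassO6 W 3)
    (hev : Even (padicValInt 3 W.minimalDiscriminantInt)) :
    Even (padicValRat 3 W.c₆) ↔ 10 ≤ padicValInt 3 W.minimalDiscriminantInt := by
  rw [← cast_integralModelInt_c₆, padicValRat.of_int, Int.even_coe_nat]
  rcases PSTamagawaThree.padicValInt_c₆_of_classO6_of_even W hO6 hev with
    ⟨h, h'⟩ | ⟨h, h'⟩ | ⟨h, h'⟩ | ⟨h, h'⟩ <;> rw [h, h'] <;> decide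

/-- **The table entry**: on the principal-series rows `condExp W 3 = 4`, and
`ordSideKodairaThree 4 (K₃ W) = true` iff `K₃ ∈ {IV*, II*}` iff `v₃Δ_min ≥ 10`. [cite: Papadopoulos1993, Table (p = 3)] -/
theorem ordSideKodairaThree_eq_true_iff_of_psRow (hO6 : ClassO6 W 3)
    (hev : Even (padicValInt 3 W.minimalDiscriminantInt)) :
    ordSideKodairaThree (condExp W 3) (W.kodairaSymbolAt (placeOf 3)) = true ↔
      10 ≤ padicValInt 3 W.minimalDiscriminantInt := by
  obtain ⟨-, hadd, hW⟩ := hO6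
  rw [(PSKodairaDictionary.condExp_eq_four_iff_even W hadd hW).mpr hev]
  rcases PSKodairaDictionary.kodairaSymbolAt_of_even W hadd hW hev with
    ⟨hK, h⟩ | ⟨hK, h⟩ | ⟨hK, h⟩ | ⟨hK, h⟩ <;> rw [hK, h] <;> decide

/-- **ORD-side ⟺ `v₃Δ_min ≥ 10` and ET-side ⟺ `v₃Δ_min ≤ 6`** on the principal-series rows carrying a unique
stable line. [cite: Serre1972, §1.11] [cite: Kraus1990, Théorème (p = 3)] -/
theorem shapeOrdSideThree_iff_of_psRow (hO6 : ClassO6 W 3)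
    (hev : Even (padicValInt 3 W.minimalDiscriminantInt)) (h1 : ∃ x₀, IsUniqueStableLineThree W x₀) :
    (ShapeOrdSideThree W ↔ 10 ≤ padicValInt 3 W.minimalDiscriminantInt) ∧
      (ShapeEtSideThree W ↔ padicValInt 3 W.minimalDiscriminantInt ≤ 6) := by
  have hpar := even_padicValRat_c₆_iff_of_psRow W hO6 hev
  refine ⟨by rw [shapeOrdSideThree_iff_even W h1, hpar], ?_⟩
  rw [shapeEtSideThree_iff_odd W h1, ← Int.not_even_iff_odd, hpar]
  rcases PSTamagawaThree.padicValInt_c₆_of_classO6_of_even W hO6 hev with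
    ⟨h, -⟩ | ⟨h, -⟩ | ⟨h, -⟩ | ⟨h, -⟩ <;> rw [h] <;> decide

omit W [W.IsElliptic] [W.IsGloballyMinimal] in
/-- **HEADLINE — the `v₃N = 4` row of the SHAPE LAW is a theorem.** For every elliptic, globally minimal
`W/ℚ` on the cyclic wild cell at `3` (`ClassO6 W 3`, `v₃Δ_min` even — equivalently `condExp W 3 = 4`):
ORD-side ⟹ `ordSideKodairaThree (condExp W 3) (K₃ W) = true` and ET-side ⟹ `= false` — the two conjuncts of
`@[conjecture] WildThreeResidualShapeByKodaira` on this row (the node itself, which also covers `v₃N ∈ {3,5}`,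
is not discharged). [cite: Kraus1990, Théorème (p = 3)] [cite: Serre1972, §1.11] -/
theorem wildThreeResidualShapeByKodaira_row_four :
    ∀ (W : WeierstrassCurve ℚ) [W.IsElliptic] [W.IsGloballyMinimal], ClassO6 W 3 →
      Even (padicValInt 3 W.minimalDiscriminantInt) →
      (ShapeOrdSideThree W → ordSideKodairaThree (condExp W 3) (W.kodairaSymbolAt (placeOf 3)) = true) ∧
      (ShapeEtSideThree W → ordSideKodairaThree (condExp W 3) (W.kodairaSymbolAt (placeOf 3)) = false) := by
  intro W _ _ hO6 hev
  constructor
  · intro hOrd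
    have h1 : ∃ x₀, IsUniqueStableLineThree W x₀ := by
      rcases hOrd with ⟨x₀, hx, -⟩ | ⟨x₀, hx, -⟩ <;> exact ⟨x₀, hx⟩
    rw [ordSideKodairaThree_eq_true_iff_of_psRow W hO6 hev]
    exact ((shapeOrdSideThree_iff_of_psRow W hO6 hev h1).1).mp hOrd
  · intro hEt
    have h1 : ∃ x₀, IsUniqueStableLineThree W x₀ := by
      rcases hEt with ⟨x₀, hx, -⟩ | ⟨x₀, hx, -⟩ <;> exact ⟨x₀, hx⟩
    have hle := ((shapeOrdSideThree_iff_of_psRow W hO6 hev h1).2).mp hEt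
    cases hb : ordSideKodairaThree (condExp W 3) (W.kodairaSymbolAt (placeOf 3))
    · rfl
    · have := (ordSideKodairaThree_eq_true_iff_of_psRow W hO6 hev).mp hb
      omega

omit W [W.IsElliptic] [W.IsGloballyMinimal] in
/-- The same row in x11b3's `c₆`-parity currency (`wildThreeResidualShapeByKodaira_iff_even_c₆`, right-hand
side, restricted to `condExp W 3 = 4`): on the principal-series rows `ordSideKodairaThree = true ⟺ v₃(c₆)` even —
with NO need for the one-stable-line hypothesis. [cite: Kraus1990, Théorème (p = 3)] -/
theorem ordSideKodairaThree_iff_even_c₆_row_four :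
    ∀ (W : WeierstrassCurve ℚ) [W.IsElliptic] [W.IsGloballyMinimal], ClassO6 W 3 →
      Even (padicValInt 3 W.minimalDiscriminantInt) →
      (ordSideKodairaThree (condExp W 3) (W.kodairaSymbolAt (placeOf 3)) = true ↔
        Even (padicValRat 3 W.c₆)) := by
  intro W _ _ hO6 hev
  rw [ordSideKodairaThree_eq_true_iff_of_psRow W hO6 hev, even_padicValRat_c₆_iff_of_psRow W hO6 hev]

/-- **The `II` and `IV` rows are a one-stable-line locus** (`v₃Δ_min ∈ {4, 6}`; this seat's
`exists_isUniqueStableLineThree_of_kodairaII` / `…_of_kodairaIV`). [cite: Serre1972, §1.11] -/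
theorem exists_isUniqueStableLineThree_of_psRow_of_le_six (hO6 : ClassO6 W 3)
    (hev : Even (padicValInt 3 W.minimalDiscriminantInt)) (hle : padicValInt 3 W.minimalDiscriminantInt ≤ 6) :
    ∃ x₀, IsUniqueStableLineThree W x₀ := by
  obtain ⟨-, hadd, hW⟩ := hO6
  rcases PSKodairaDictionary.kodairaSymbolAt_of_even W hadd hW hev with
    ⟨hK, h⟩ | ⟨hK, h⟩ | ⟨-, h⟩ | ⟨-, h⟩
  · exact exists_isUniqueStableLineThree_of_kodairaII W hK h
  · exact exists_isUniqueStableLineThree_of_kodairaIV W hK h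
  · omega
  · omega

/-- **The six-shape reading on the `II`/`IV` rows**: the local residual shape is ET-side, and it is ET1
(stable line acted on trivially: `W(ℚ₃)[3] ≠ 0`) iff `c₆(W_ℤ)/3^{v₃c₆} % 3 = 1`, ETM otherwise.
[cite: Serre1972, §1.11] -/
theorem shapeEtSideThree_of_psRow_of_le_six (hO6 : ClassO6 W 3)
    (hev : Even (padicValInt 3 W.minimalDiscriminantInt)) (hle : padicValInt 3 W.minimalDiscriminantInt ≤ 6) :
    ShapeEtSideThree W ∧
      (ShapeET1Three W ↔
        (integralModelInt W).c₆ / 3 ^ padicValInt 3 (integralModelInt W).c₆ % 3 = 1) := by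
  have h1 := exists_isUniqueStableLineThree_of_psRow_of_le_six W hO6 hev hle
  refine ⟨((shapeOrdSideThree_iff_of_psRow W hO6 hev h1).2).mpr hle, ?_⟩
  rw [← not_noLocalThreeTorsionAt_iff_shapeET1Three W h1, not_noLocalThreeTorsionAt_three_iff_of_psRow W hO6 hev]
  exact ⟨fun h ↦ h.2, fun h ↦ ⟨hle, h⟩⟩

end RowFour

end Summit.BirchSwinnertonDyer.BirchSwinnertonDyer.Theorems.PSLocalThreeTorsion

end
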